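import Summits.QuantumFields.YangMills.Theorems.IR.BlockedActivityWCentreRatio
import Summits.QuantumFields.YangMills.Theorems.BalabanLadderNTStrongCouplingInfluence
import Summits.QuantumFields.YangMills.Theorems.BalabanLadderIRFrameCells
import HarnessLib

/-!
# Crux `IR` (stmt-QuantumFields-19354), lane B «strong coupling AFTER BLOCKING»: frame geometry and boundary-action bookkeeping for the
# strong-coupling class-W theorem at every mesh (part 1∕2: no estimates)

Helper module for item `stmt-QuantumFields-19354` (`--supports`; it closes nothing), lane `ym-19354-onsetsc-p2` (g3).  Preparations for
`Theorems/IR/BlockedActivityWStrongCouplingMesh`: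

* §1 frame geometry (on the tree's `frameCell` of `BalabanLadderIRFrameCells`): links within sup-distance `1` of a centre link are window links
  (`mem_windowRegion_of_near_centre`, `n ≥ 1`), so plaquettes through the centre cell stay in the window; links OFF the window sit at sup-distance
  `≥ 2nb + 1` from every base point of the centre cell (`far_of_not_mem_windowRegion`); `#cellEdges ≤ 64 b⁴`, `#plaquette-neighbourhood ≤ 24`.
* §2 boundary actions: shrinking the volume from the region `Λ` to the inner volume `Λ' = Λ ∖ centre` does not change a difference of boundary
  actions of two configurations that agree on the window (`wilsonBoundaryAction_sub_eq_of_subset`, `bcRatio_region_eq_inner`); the boundary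
  ratio of the region does not read the centre links (`bcRatio_update_centre`); the one-link Boltzmann ratio `linkRatio` at a centre link is a
  cylinder on the plaquette neighbourhood of the link and does not distinguish two exteriors agreeing on the window (`linkRatio_glueWith_eq`).

HONEST FRAMING: bookkeeping; nothing about mixing, a gap or Clay.  No `sorry`; axioms ⊆ {propext, Classical.choice, Quot.sound}; no instances,
no notation.
-/

set_option autoImplicit false

noncomputable section

open MeasureTheory ProbabilityTheory
open Literature.MathematicalPhysics.QuantumLattice
open Literature.Probability.LatticeModels
open Summit.QuantumFields.YangMills.Cruxes.IR.Tempered (cellEdges windowCells regionEdges collarEdges)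
open Summit.QuantumFields.YangMills.Cruxes.IR.CellTempered.Engine (frameCell frameCell_eq_iff mem_cellEdges_frameCell frame_hC1
  frame_add_nat_le shiftFrame shiftFrame_mesh)

namespace Summit.QuantumFields.YangMills.Cruxes.IR.BlockedActivity


/-! ## §1 Frame geometry: plaquettes through the centre cell stay in the window; links off the window are far from the centre -/

section Geometry

variable {w : Fin 4 → ℤ → ℤ} {b n : ℕ}

/-- A mesh-`b` frame with `b ≥ 1` gains at least `1` per step. -/
theorem frame_step (hw : AfPincerUc.IsFrame b w) (hb : 1 ≤ b) : ∀ i j, w i j + 1 ≤ w i (j + 1) := fun i j => by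
  have h := (hw i j).1
  have hb' : (1 : ℤ) ≤ ((b : ℕ) : ℤ) := by exact_mod_cast hb
  linarith

/-- A mesh-`b` frame gains at least `m·b` in `m` steps. -/
theorem frame_add_mul_le (hw : AfPincerUc.IsFrame b w) (i : Fin 4) (j : ℤ) (m : ℕ) :
    w i j + (m : ℤ) * ((b : ℕ) : ℤ) ≤ w i (j + m) := by
  induction m with
  | zero => simp
  | succ m ih =>
    have h1 := (hw i (j + m)).1
    have e1 : (j + ((m + 1 : ℕ) : ℤ)) = j + (m : ℤ) + 1 := by push_cast; ring
    have e2 : (((m + 1 : ℕ) : ℤ)) * ((b : ℕ) : ℤ) = (m : ℤ) * ((b : ℕ) : ℤ) + ((b : ℕ) : ℤ) := by push_cast; ring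
    rw [e1, e2]
    linarith

/-- A frame is monotone. -/
theorem frame_mono (hw : AfPincerUc.IsFrame b w) (i : Fin 4) {j j' : ℤ} (h : j ≤ j') : w i j ≤ w i j' := by
  obtain ⟨m, rfl⟩ : ∃ m : ℕ, j' = j + m := ⟨(j' - j).toNat, by rw [Int.toNat_of_nonneg (by omega)]; ring⟩
  have := frame_add_mul_le hw i j m
  nlinarith [Int.natCast_nonneg m, Int.natCast_nonneg b]

/-- A cell of a mesh-`b` frame has at most `64·b⁴` links (sides `≤ 2b`, four directions). -/
theorem card_cellEdges_le_mesh (hw : AfPincerUc.IsFrame b w) (c : Cell) : (cellEdges w c).card ≤ 64 * b ^ 4 := by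
  unfold Summit.QuantumFields.YangMills.Cruxes.IR.Tempered.cellEdges
  rw [Finset.card_product, Fintype.card_piFinset, Finset.card_univ, Fintype.card_fin]
  have h : ∀ i : Fin 4, (Finset.Ico (w i (c i)) (w i (c i + 1))).card ≤ 2 * b := fun i => by
    rw [Int.card_Ico]
    refine Int.toNat_le.2 ?_
    have := (hw i (c i)).2
    push_cast at this ⊢
    omega
  have hp : (∏ i : Fin 4, (Finset.Ico (w i (c i)) (w i (c i + 1))).card) ≤ (2 * b) ^ 4 := by
    have := Finset.prod_le_pow_card (Finset.univ : Finset (Fin 4))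
      (fun i => (Finset.Ico (w i (c i)) (w i (c i + 1))).card) (2 * b) fun i _ => h i
    simpa using this
  calc (∏ i : Fin 4, (Finset.Ico (w i (c i)) (w i (c i + 1))).card) * 4 ≤ (2 * b) ^ 4 * 4 := Nat.mul_le_mul_right 4 hp
    _ = 64 * b ^ 4 := by ring

/-- **Links within sup-distance `1` of a centre link are window links** (`n ≥ 1`): their frame cell has index of sup-norm `≤ 1 ≤ 2n`. -/
theorem mem_windowRegion_of_near_centre (hw : AfPincerUc.IsFrame b w) (hb : 1 ≤ b) (hn : 1 ≤ n) {e y : ZdEdge 4}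
    (he : e ∈ cellEdges w 0) (h : ‖y.1 - e.1‖ ≤ (1 : ℝ)) : y ∈ regionEdges w (windowCells n) := by
  have hw1 := frame_step hw hb
  have hcell : frameCell w e = 0 := (frameCell_eq_iff hw1 e 0).2 he
  have hidx : ∀ k, |frameCell w y k| ≤ 1 := fun k => by
    have hk := frame_hC1 hw1 y e (fun k => by
      have := abs_le.1 (NT.StrongCoupling.abs_sub_le_one_of_norm_le_one h k); constructor <;> omega) k
    rw [hcell] at hk
    simpa using hk
  refine Finset.mem_biUnion.2 ⟨frameCell w y, ?_, mem_cellEdges_frameCell hw1 y⟩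
  simp only [Summit.QuantumFields.YangMills.Cruxes.IR.Tempered.windowCells, Fintype.mem_piFinset, Finset.mem_Icc]
  intro k
  have := abs_le.1 (hidx k)
  constructor <;> omega

/-- The links of the plaquettes through a centre link are window links (`n ≥ 1`). -/
theorem plaqNbhd_subset_windowRegion (hw : AfPincerUc.IsFrame b w) (hb : 1 ≤ b) (hn : 1 ≤ n) {a : ZdEdge 4}
    (ha : a ∈ cellEdges w 0) {y : ZdEdge 4} (hy : y ∈ (plaquettesTouching ({a} : Finset (ZdEdge 4))).biUnion plaquetteEdges) :
    y ∈ regionEdges w (windowCells n) := by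
  obtain ⟨p, hp, hyp⟩ := Finset.mem_biUnion.1 hy
  have hap : a ∈ plaquetteEdges p := Literature.MathematicalPhysics.QuantumFieldTheory.mem_plaquettesTouching_singleton.1 hp
  have h1 : ‖y.1 - a.1‖ ≤ (1 : ℝ) := Literature.MathematicalPhysics.QuantumFieldTheory.norm_sub_le_one_of_mem_plaquetteEdges hyp hap
  exact mem_windowRegion_of_near_centre hw hb hn ha h1

/-- A plaquette with a link in the centre cell has all its links in the window (`n ≥ 1`). -/
theorem plaquetteEdges_subset_windowRegion (hw : AfPincerUc.IsFrame b w) (hb : 1 ≤ b) (hn : 1 ≤ n) {p : ZdPlaquette 4} {e : ZdEdge 4}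
    (hep : e ∈ plaquetteEdges p) (he : e ∈ cellEdges w 0) {y : ZdEdge 4} (hy : y ∈ plaquetteEdges p) :
    y ∈ regionEdges w (windowCells n) :=
  mem_windowRegion_of_near_centre hw hb hn he (Literature.MathematicalPhysics.QuantumFieldTheory.norm_sub_le_one_of_mem_plaquetteEdges hy hep)

/-- **Links off the window are far from the centre cell**: a link outside `regionEdges w (windowCells n)` has base point at sup-distance
`≥ 2nb + 1` from any base point of the centre cell. -/
theorem far_of_not_mem_windowRegion (hw : AfPincerUc.IsFrame b w) (hb : 1 ≤ b) {z : ZdEdge 4} (hz : z ∉ regionEdges w (windowCells n))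
    {y : Fin 4 → ℤ} (hy : ∀ k, w k 0 ≤ y k ∧ y k < w k 1) : 2 * n * b + 1 ≤ ⌊‖z.1 - y‖⌋₊ := by
  have hw1 := frame_step hw hb
  set c := frameCell w z with hc
  have hzc : z ∈ cellEdges w c := mem_cellEdges_frameCell hw1 z
  have hcn : c ∉ windowCells n := fun hcn => hz (Finset.mem_biUnion.2 ⟨c, hcn, hzc⟩)
  -- a coordinate of the cell index outside `[-2n, 2n]`
  have hk : ∃ k, ¬ (-(2 * ((n : ℕ) : ℤ)) ≤ c k ∧ c k ≤ 2 * ((n : ℕ) : ℤ)) := by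
    by_contra hall
    push Not at hall
    exact hcn (by
      simp only [Summit.QuantumFields.YangMills.Cruxes.IR.Tempered.windowCells, Fintype.mem_piFinset, Finset.mem_Icc]
      exact hall)
  obtain ⟨k, hk⟩ := hk
  -- the link's coordinate `k` lies in the cell's `k`-range
  have hzk : w k (c k) ≤ z.1 k ∧ z.1 k < w k (c k + 1) := by
    simp only [Summit.QuantumFields.YangMills.Cruxes.IR.Tempered.cellEdges, Finset.mem_product, Fintype.mem_piFinset,
      Finset.mem_Ico] at hzc
    exact hzc.1 k
  have hyk := hy k
  -- the gap in coordinate `k` is at least `2nb + 1`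
  have hgap : (2 * n * b + 1 : ℤ) ≤ |z.1 k - y k| := by
    have h2n := frame_add_mul_le hw k 1 (2 * n)
    have h2n' := frame_add_mul_le hw k (-(2 * ((n : ℕ) : ℤ))) (2 * n)
    push_cast at h2n h2n' ⊢
    rw [show -(2 * (n : ℤ)) + 2 * (n : ℤ) = 0 by ring] at h2n'
    rcases not_and_or.1 hk with hlo | hhi
    · -- `c k ≤ -2n-1`: the link sits below the window
      push Not at hlo
      have hm : w k (c k + 1) ≤ w k (-(2 * (n : ℤ))) := frame_mono hw k (by omega)
      rw [abs_of_nonpos (by nlinarith)]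
      nlinarith
    · -- `c k ≥ 2n+1`: the link sits above the window
      push Not at hhi
      have hm : w k (1 + 2 * (n : ℤ)) ≤ w k (c k) := frame_mono hw k (by omega)
      rw [abs_of_nonneg (by nlinarith)]
      nlinarith
  -- sup-norm dominates the coordinate
  have hnorm : ((2 * n * b + 1 : ℕ) : ℝ) ≤ ‖z.1 - y‖ := by
    have h1 : ‖(z.1 - y) k‖ ≤ ‖z.1 - y‖ := norm_le_pi_norm _ k
    rw [Pi.sub_apply, Int.norm_eq_abs, Int.cast_sub] at h1
    have h2 : ((2 * n * b + 1 : ℕ) : ℝ) ≤ |((z.1 k : ℤ) : ℝ) - ((y k : ℤ) : ℝ)| := by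
      rw [← Int.cast_sub, ← Int.cast_abs]; exact_mod_cast hgap
    exact h2.trans h1
  exact Nat.le_floor hnorm

/-- The plaquette neighbourhood of a link has at most `24` links. -/
theorem card_plaqNbhd_le (a : ZdEdge 4) : ((plaquettesTouching ({a} : Finset (ZdEdge 4))).biUnion plaquetteEdges).card ≤ 24 := by
  calc ((plaquettesTouching ({a} : Finset (ZdEdge 4))).biUnion plaquetteEdges).card
      ≤ ∑ p ∈ plaquettesTouching ({a} : Finset (ZdEdge 4)), (plaquetteEdges p).card := Finset.card_biUnion_le
    _ ≤ (plaquettesTouching ({a} : Finset (ZdEdge 4))).card • 4 :=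
        Finset.sum_le_card_nsmul _ _ _ fun p _ => Literature.MathematicalPhysics.QuantumFieldTheory.card_plaquetteEdges_le p
    _ ≤ 6 * 4 := by
        rw [smul_eq_mul]
        exact Nat.mul_le_mul_right 4 (by simpa using Literature.MathematicalPhysics.QuantumFieldTheory.card_plaquettesTouching_singleton_le a)
    _ = 24 := by norm_num

/-- Links of the plaquette neighbourhood of `a` are within sup-distance `1` of `a`. -/
theorem floor_norm_le_one_of_mem_plaqNbhd {a z : ZdEdge 4} (hz : z ∈ (plaquettesTouching ({a} : Finset (ZdEdge 4))).biUnion plaquetteEdges) :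
    ⌊‖z.1 - a.1‖⌋₊ ≤ 1 := by
  obtain ⟨p, hp, hzp⟩ := Finset.mem_biUnion.1 hz
  have hap : a ∈ plaquetteEdges p := Literature.MathematicalPhysics.QuantumFieldTheory.mem_plaquettesTouching_singleton.1 hp
  have h1 : ‖z.1 - a.1‖ ≤ (1 : ℝ) := Literature.MathematicalPhysics.QuantumFieldTheory.norm_sub_le_one_of_mem_plaquetteEdges hzp hap
  calc ⌊‖z.1 - a.1‖⌋₊ ≤ ⌊(1 : ℝ)⌋₊ := Nat.floor_mono h1
    _ = 1 := Nat.floor_one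

end Geometry

/-! ## §2 The boundary actions seen from the region and from the inner volume -/

section Actions

variable {G : Type} [Group G] {N : ℕ} (ρ : G →* Matrix (Fin N) (Fin N) ℂ)

/-- **Shrinking the volume does not change a difference of boundary actions** when the two configurations agree on every plaquette that
touches the large volume but not the small one. -/
theorem wilsonBoundaryAction_sub_eq_of_subset {d : ℕ} {Λ Λ' : Finset (ZdEdge d)} (hsub : Λ' ⊆ Λ) {X₁ X₂ : LGConfig d G}
    (h : ∀ p ∈ plaquettesTouching Λ, p ∉ plaquettesTouching Λ' → ∀ e ∈ plaquetteEdges p, X₁ e = X₂ e) :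
    wilsonBoundaryAction ρ Λ X₁ - wilsonBoundaryAction ρ Λ X₂ = wilsonBoundaryAction ρ Λ' X₁ - wilsonBoundaryAction ρ Λ' X₂ := by
  classical
  unfold wilsonBoundaryAction
  rw [← Finset.sum_sub_distrib, ← Finset.sum_sub_distrib]
  symm
  refine Finset.sum_subset (fun p hp => ?_) (fun p hp hp' => ?_)
  · rw [mem_plaquettesTouching_iff] at hp ⊢
    obtain ⟨e, he⟩ := hp
    exact ⟨e, Finset.mem_inter.2 ⟨(Finset.mem_inter.1 he).1, hsub (Finset.mem_inter.1 he).2⟩⟩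
  · rw [isCylinder_plaquetteObs ρ p fun e he => h p hp hp' e (Finset.mem_coe.1 he)]
    ring

variable {w : Fin 4 → ℤ → ℤ} {b n : ℕ} {Y : Finset Cell} {σ τ : LGConfig 4 G}

omit [Group G] in
/-- Data in the agreement class of `τ` agree with `τ` on every window link off the region. -/
theorem eq_of_mem_windowAgree (hσ : σ ∈ WindowAgree w n Y τ) {e : ZdEdge 4} (he : e ∈ regionEdges w (windowCells n))
    (heY : e ∉ regionEdges w Y) : σ e = τ e :=
  hσ e (Finset.mem_sdiff.2 ⟨he, heY⟩)

omit [Group G] in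
/-- **A plaquette touching the region but not the inner volume lies in the window**, so the splices of one configuration with two data of
one agreement class agree on it. -/
theorem splice_agree_on_plaquette (hw : AfPincerUc.IsFrame b w) (hb : 1 ≤ b) (hn : 1 ≤ n) (hσ : σ ∈ WindowAgree w n Y τ)
    {p : ZdPlaquette 4} (hp : p ∈ plaquettesTouching (regionEdges w Y)) (hp' : p ∉ plaquettesTouching (innerEdges w Y))
    (V : LGConfig 4 G) : ∀ e ∈ plaquetteEdges p, splice (regionEdges w Y) V σ e = splice (regionEdges w Y) V τ e := by
  -- an edge of `p` in the region but not in the inner volume is a centre link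
  obtain ⟨e₀, he₀⟩ := mem_plaquettesTouching_iff.1 hp
  have he₀p : e₀ ∈ plaquetteEdges p := (Finset.mem_inter.1 he₀).1
  have he₀Λ : e₀ ∈ regionEdges w Y := (Finset.mem_inter.1 he₀).2
  have he₀c : e₀ ∈ cellEdges w 0 := by
    by_contra hc
    exact hp' (mem_plaquettesTouching_iff.2 ⟨e₀, Finset.mem_inter.2 ⟨he₀p, Finset.mem_sdiff.2 ⟨he₀Λ, hc⟩⟩⟩)
  intro e he
  by_cases heΛ : e ∈ regionEdges w Y
  · rw [splice_apply_mem _ _ _ heΛ, splice_apply_mem _ _ _ heΛ]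
  · rw [splice_apply_not_mem _ _ _ heΛ, splice_apply_not_mem _ _ _ heΛ]
    exact eq_of_mem_windowAgree hσ (plaquetteEdges_subset_windowRegion hw hb hn he₀p he₀c he) heΛ

/-- **The boundary ratio of the region equals that of the inner volume** with the exterior pair «(`ζ` on the region, `σ` off), `ζ`», on every
configuration equal to `ζ` off the inner volume — when `ζ = τ` off the region and `σ` agrees with `τ` on the window (`n ≥ 1`). -/
theorem bcRatio_region_eq_inner (hw : AfPincerUc.IsFrame b w) (hb : 1 ≤ b) (hn : 1 ≤ n) (hσ : σ ∈ WindowAgree w n Y τ) (β : ℝ)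
    {ζ : LGConfig 4 G} (hζ : ∀ e ∉ regionEdges w Y, ζ e = τ e) {V : LGConfig 4 G} (hV : ∀ e ∉ innerEdges w Y, V e = ζ e) :
    bcRatio ρ β (regionEdges w Y) σ τ V = bcRatio ρ β (innerEdges w Y) (splice (regionEdges w Y) ζ σ) ζ V := by
  -- the two exterior pairs give the SAME pair of configurations
  have h1 : splice (innerEdges w Y) V (splice (regionEdges w Y) ζ σ) = splice (regionEdges w Y) V σ := by
    funext e
    by_cases he' : e ∈ innerEdges w Y
    · rw [splice_apply_mem _ _ _ he', splice_apply_mem _ _ _ (innerEdges_subset w Y he')]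
    · rw [splice_apply_not_mem _ _ _ he']
      by_cases he : e ∈ regionEdges w Y
      · rw [splice_apply_mem _ _ _ he, splice_apply_mem _ _ _ he, hV e he']
      · rw [splice_apply_not_mem _ _ _ he, splice_apply_not_mem _ _ _ he]
  have h2 : splice (innerEdges w Y) V ζ = splice (regionEdges w Y) V τ := by
    funext e
    by_cases he' : e ∈ innerEdges w Y
    · rw [splice_apply_mem _ _ _ he', splice_apply_mem _ _ _ (innerEdges_subset w Y he')]
    · rw [splice_apply_not_mem _ _ _ he']
      by_cases he : e ∈ regionEdges w Y
      · rw [splice_apply_mem _ _ _ he, hV e he']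
      · rw [splice_apply_not_mem _ _ _ he, hζ e he]
  unfold bcRatio
  rw [h1, h2, wilsonBoundaryAction_sub_eq_of_subset ρ (innerEdges_subset w Y)
    (fun p hp hp' => splice_agree_on_plaquette hw hb hn hσ hp hp' V)]

/-- **The boundary ratio of the region does not read the centre links** (`n ≥ 1`): plaquettes through a centre link lie in the window, where
the two splices agree. -/
theorem bcRatio_update_centre (hw : AfPincerUc.IsFrame b w) (hb : 1 ≤ b) (hn : 1 ≤ n) (hσ : σ ∈ WindowAgree w n Y τ) (β : ℝ)
    {a : ZdEdge 4} (ha : a ∈ cellEdges w 0) (V : LGConfig 4 G) (x : G) :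
    bcRatio ρ β (regionEdges w Y) σ τ (Function.update V a x) = bcRatio ρ β (regionEdges w Y) σ τ V := by
  classical
  unfold bcRatio wilsonBoundaryAction
  congr 2
  rw [← Finset.sum_sub_distrib, ← Finset.sum_sub_distrib]
  refine Finset.sum_congr rfl fun p hp => ?_
  by_cases hap : a ∈ plaquetteEdges p
  · -- a plaquette through the centre link: both differences vanish
    have hwin : ∀ e ∈ plaquetteEdges p, ∀ W : LGConfig 4 G, splice (regionEdges w Y) W σ e = splice (regionEdges w Y) W τ e := by
      intro e he W
      by_cases heΛ : e ∈ regionEdges w Y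
      · rw [splice_apply_mem _ _ _ heΛ, splice_apply_mem _ _ _ heΛ]
      · rw [splice_apply_not_mem _ _ _ heΛ, splice_apply_not_mem _ _ _ heΛ]
        exact eq_of_mem_windowAgree hσ (plaquetteEdges_subset_windowRegion hw hb hn hap ha he) heΛ
    rw [isCylinder_plaquetteObs ρ p fun e he => hwin e (Finset.mem_coe.1 he) (Function.update V a x),
      isCylinder_plaquetteObs ρ p fun e he => hwin e (Finset.mem_coe.1 he) V]
    ring
  · -- a plaquette avoiding the centre link: the update is invisible
    have hinv : ∀ η : LGConfig 4 G, ∀ e ∈ plaquetteEdges p,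
        splice (regionEdges w Y) (Function.update V a x) η e = splice (regionEdges w Y) V η e := by
      intro η e he
      have hea : e ≠ a := fun h => hap (h ▸ he)
      by_cases heΛ : e ∈ regionEdges w Y
      · rw [splice_apply_mem _ _ _ heΛ, splice_apply_mem _ _ _ heΛ, Function.update_of_ne hea]
      · rw [splice_apply_not_mem _ _ _ heΛ, splice_apply_not_mem _ _ _ heΛ]
    rw [isCylinder_plaquetteObs ρ p fun e he => hinv σ e (Finset.mem_coe.1 he),
      isCylinder_plaquetteObs ρ p fun e he => hinv τ e (Finset.mem_coe.1 he)]

/-- **The one-link Boltzmann ratio at a centre link** for the inner volume: `E_a(V) = exp(−β [S_{Λ'}(V^{a←x}) − S_{Λ'}(V)])`. -/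
def linkRatio (β : ℝ) (w : Fin 4 → ℤ → ℤ) (Y : Finset Cell) (a : ZdEdge 4) (x : G) (V : LGConfig 4 G) : ℝ :=
  Real.exp (-β * (wilsonBoundaryAction ρ (innerEdges w Y) (Function.update V a x) - wilsonBoundaryAction ρ (innerEdges w Y) V))

/-- The one-link ratio is a cylinder on the plaquette neighbourhood of the link (tree `isCylinder_boltzmannRatio`). -/
theorem dependsOn_linkRatio (β : ℝ) (a : ZdEdge 4) (x : G) :
    DependsOn (linkRatio ρ β w Y a x) ↑((plaquettesTouching ({a} : Finset (ZdEdge 4))).biUnion plaquetteEdges) := by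
  have h := isCylinder_boltzmannRatio ρ β (innerEdges w Y) a x 1
  simp only [one_mul] at h
  exact h

/-- The one-link ratio does not distinguish two gluings with exteriors that agree on the window links (here: «`ζ` on the region, `σ` off»
versus `ζ` with `ζ = τ` off the region), `a` a centre link, `n ≥ 1`. -/
theorem linkRatio_glueWith_eq (hw : AfPincerUc.IsFrame b w) (hb : 1 ≤ b) (hn : 1 ≤ n) (hσ : σ ∈ WindowAgree w n Y τ) (β : ℝ)
    {ζ : LGConfig 4 G} (hζ : ∀ e ∉ regionEdges w Y, ζ e = τ e) {a : ZdEdge 4} (ha : a ∈ cellEdges w 0) (x : G)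
    (u : ↥(innerEdges w Y) → G) :
    linkRatio ρ β w Y a x (glueWith (innerEdges w Y) u (splice (regionEdges w Y) ζ σ)) =
      linkRatio ρ β w Y a x (glueWith (innerEdges w Y) u ζ) := by
  refine dependsOn_linkRatio ρ β a x fun e he => ?_
  have hew : e ∈ regionEdges w (windowCells n) := plaqNbhd_subset_windowRegion hw hb hn ha (Finset.mem_coe.1 he)
  by_cases he' : e ∈ innerEdges w Y
  · rw [glueWith_apply_mem _ _ _ he', glueWith_apply_mem _ _ _ he']
  · rw [glueWith_apply_not_mem _ _ _ he', glueWith_apply_not_mem _ _ _ he']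
    by_cases heΛ : e ∈ regionEdges w Y
    · rw [splice_apply_mem _ _ _ heΛ]
    · rw [splice_apply_not_mem _ _ _ heΛ, hζ e heΛ]
      exact eq_of_mem_windowAgree hσ hew heΛ

end Actions

end Summit.QuantumFields.YangMills.Cruxes.IR.BlockedActivity

end
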